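import Literature.AlgebraicGeometry.Resolution.FineModels
import Mathlib.FieldTheory.PrimitiveElement
import Mathlib.FieldTheory.Minpoly.IsIntegrallyClosed
import Mathlib.RingTheory.Polynomial.ScaleRoots
import Mathlib.FieldTheory.AlgebraicClosure
import HarnessLib

/-!
# The constants of the chart datum of Thm. 3.3.1: an integral primitive constant and its Galois hull

Topic: `Literature/AlgebraicGeometry/Resolution` (valued fields; field theory). Plumbing for
the assembly of M. Temkin, *Inseparable local uniformization*, J. Algebra 373 (2013) 65–119 =
arXiv:0804.1554v3, Thm. 3.3.1 (tree: `Temkin2013RelativeCurveSmoothFibre`). The valuative input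
of the algebraic proof delivers a FINITE SET `Y` of constants — elements of a subfield `L ≤ Ω`
(the henselization of the valued function field) separable algebraic over the ground field `k`
— whereas the chart datum (`RelCurveChart`, `RelativeCurveChartSetup.lean`) wants ONE primitive
constant `y₀ ∈ L`, a `k°`-INTEGRAL unit-ball element (its minimal polynomial over `k` has
coefficients in `k°`, so that the Hensel chart lives over the model), together with a finite
Galois `M ⊇ m = k(y₀)` containing all `k`-conjugates of the elements of `m` and such that
`M ∩ L ⊆ m`. This file produces them (classical field theory):

* `exists_mem_valuationSubring_forall_mul_mem` — finitely many elements of `k` have a common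
  non-zero "denominator" in `k°` — PROVED;
* `exists_smul_isIntegral_valuationSubring`, `coeff_minpoly_mem_of_isIntegral` — scaling an
  algebraic element by a constant of `k°` makes it `k°`-integral, and then its minimal
  polynomial over `k` has coefficients in `k°` (valuation rings are integrally closed) — PROVED;
* `mem_valuationSubring_of_isIntegral_valuationSubring` — a `k°`-integral element lies in every
  valuation ring of `Ω` over `k°` — PROVED;
* `exists_galois_hull`, `exists_primitive_integral_constant` — **the primitive constant**: for
  `Y ⊆ L` finite and separable over `k` there is `y₀ ∈ L ∩ O_V`, separable and `k°`-integral
  (minimal polynomial with coefficients in `k°`), with `k(Y) ≤ k(y₀) = M₀ ∩ L` for the normal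
  hull `M₀` of `k(Y)` in `Ω` (finite Galois over `k`, containing every `k`-conjugate of every
  element of `M₀`) — PROVED;
* `exists_galois_over_constants` — the hull as an intermediate field of `\overline{m}^{Ω}/m`,
  finite Galois over `m = k(y₀)`, with `M ∩ L ⊆ m` and all `k`-conjugates of elements of `m`
  (the fields `M, finM, galM, hML, hconjM` of `RelCurveChart`) — PROVED.

All statements are [folklore]; no definitions, no named facts.

## Sources

* M. Temkin, arXiv:0804.1554v3, proof of Thm. 3.3.1, Steps 2–3 (the constants `m`, and the
  finite Galois `F/l̂` with `m̂ ↪ F` of Step 3). [Temkin2013]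
-/

noncomputable section

open Polynomial

namespace Literature.AlgebraicGeometry.Resolution

universe u

/-! ### Common denominators in `k°` and `k°`-integral scalings -/

section Denominators

variable {k : Type u} [Field k] (Ok : ValuationSubring k)

/-- **Common denominators**: for finitely many `a ∈ k` there is `c ∈ k°`, `c ≠ 0`, with
`c·a ∈ k°` for all of them. [folklore] -/
theorem exists_mem_valuationSubring_forall_mul_mem (s : Finset k) :
    ∃ c ∈ Ok, c ≠ 0 ∧ ∀ a ∈ s, c * a ∈ Ok := by
  classical
  induction s using Finset.induction_on with
  | empty => exact ⟨1, Ok.one_mem, one_ne_zero, fun a ha => (Finset.notMem_empty a ha).elim⟩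
  | insert a s has ih =>
    obtain ⟨c, hc, hc0, hcs⟩ := ih
    by_cases ha : a ∈ Ok
    · refine ⟨c, hc, hc0, fun b hb => ?_⟩
      rcases Finset.mem_insert.mp hb with rfl | hb
      · exact Ok.mul_mem _ _ hc ha
      · exact hcs b hb
    · have ha0 : a ≠ 0 := fun h0 => ha (h0 ▸ Ok.zero_mem)
      have hai : a⁻¹ ∈ Ok := (Ok.mem_or_inv_mem a).resolve_left ha
      refine ⟨c * a⁻¹, Ok.mul_mem _ _ hc hai, mul_ne_zero hc0 (inv_ne_zero ha0), fun b hb => ?_⟩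
      rcases Finset.mem_insert.mp hb with rfl | hb
      · rw [mul_assoc, inv_mul_cancel₀ ha0, mul_one]; exact hc
      · rw [mul_assoc, mul_comm _ b, ← mul_assoc]
        exact Ok.mul_mem _ _ (hcs b hb) hai

variable {Ω : Type u} [Field Ω] [Algebra k Ω]

/-- **Scaling into `k°`-integrality**: for `α ∈ Ω` algebraic over `k` there is `c ∈ k°`,
`c ≠ 0`, and a monic polynomial with coefficients in `k°` killing `c·α` (the scaled minimal
polynomial). [folklore] -/
theorem exists_smul_monic_coeff_mem (α : Ω) (hα : IsIntegral k α) :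
    ∃ c ∈ Ok, c ≠ 0 ∧ ∃ q : k[X], q.Monic ∧ (∀ i, q.coeff i ∈ Ok) ∧
      aeval (algebraMap k Ω c * α) q = 0 := by
  classical
  set p := minpoly k α with hp
  obtain ⟨c, hc, hc0, hcs⟩ :=
    exists_mem_valuationSubring_forall_mul_mem Ok (p.support.image fun i => p.coeff i)
  refine ⟨c, hc, hc0, p.scaleRoots c, (monic_scaleRoots_iff c).mpr (minpoly.monic hα), fun i => ?_,
    scaleRoots_aeval_eq_zero (minpoly.aeval k α)⟩
  rw [coeff_scaleRoots]
  by_cases hi : i ∈ p.support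
  · rcases Nat.eq_zero_or_pos (p.natDegree - i) with h0 | hpos
    · -- `i = natDegree`: the coefficient is `1`
      have hle : p.natDegree ≤ i := Nat.sub_eq_zero_iff_le.mp h0
      rcases hle.lt_or_eq with hlt | heq
      · rw [coeff_eq_zero_of_natDegree_lt hlt, zero_mul]; exact Ok.zero_mem
      · subst heq
        rw [Nat.sub_self, pow_zero, mul_one, (minpoly.monic hα).coeff_natDegree]
        exact Ok.one_mem
    · obtain ⟨n, hn⟩ : ∃ n, p.natDegree - i = n + 1 := ⟨_, (Nat.succ_pred_eq_of_pos hpos).symm⟩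
      rw [hn, pow_succ, ← mul_assoc, mul_comm (p.coeff i), mul_assoc]
      exact Ok.mul_mem _ _ (Ok.pow_mem hc n) (by
        rw [mul_comm]; exact hcs _ (Finset.mem_image.mpr ⟨i, hi, rfl⟩))
  · rw [notMem_support_iff.mp hi, zero_mul]; exact Ok.zero_mem

/-- The subring `k°` of `Ω` (image of `Ok`). Integrality over it, from a monic polynomial over
`k` with coefficients in `k°`. [folklore] -/
theorem isIntegral_map_valuationSubring_of_monic {q : k[X]} (hqm : q.Monic)
    (hq : ∀ i, q.coeff i ∈ Ok) {y : Ω} (hy : aeval y q = 0) :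
    IsIntegral (Ok.toSubring.map (algebraMap k Ω)) y := by
  refine isIntegral_of_monic_of_coeff_mem (Ok.toSubring.map (algebraMap k Ω))
    (P := q.map (algebraMap k Ω)) (hqm.map _) (fun i => ?_) ?_
  · rw [coeff_map]; exact ⟨q.coeff i, hq i, rfl⟩
  · rwa [eval_map, ← aeval_def]

/-- **A `k°`-integral element lies in every valuation ring over `k°`.** [folklore] -/
theorem mem_valuationSubring_of_isIntegral_map (V : ValuationSubring Ω)
    (hV : ∀ c ∈ Ok, algebraMap k Ω c ∈ V) {y : Ω}
    (hy : IsIntegral (Ok.toSubring.map (algebraMap k Ω)) y) : y ∈ V :=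
  mem_valuationSubring_of_isIntegral_subring V (by
    rintro _ ⟨c, hc, rfl⟩
    exact hV c hc) hy

/-- **The minimal polynomial of a `k°`-integral element has coefficients in `k°`** (valuation
rings are integrally closed; `minpoly.isIntegrallyClosed_eq_field_fractions'`). [folklore] -/
theorem coeff_minpoly_mem_of_monic {q : k[X]} (hqm : q.Monic) (hq : ∀ i, q.coeff i ∈ Ok)
    {y : Ω} (hy : aeval y q = 0) (i : ℕ) : (minpoly k y).coeff i ∈ Ok := by
  classical
  -- `y` is integral over the ring `Ok` (acting on `Ω` through `k`)
  letI : Algebra Ok Ω := ((algebraMap k Ω).comp (algebraMap Ok k)).toAlgebra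
  haveI : IsScalarTower Ok k Ω := IsScalarTower.of_algebraMap_eq fun _ => rfl
  have hlifts : q ∈ Polynomial.lifts (algebraMap Ok k) := by
    rw [Polynomial.lifts_iff_coeff_lifts]
    intro n
    exact ⟨⟨q.coeff n, hq n⟩, rfl⟩
  obtain ⟨q₀, hq₀, -, hq₀m⟩ := Polynomial.lifts_and_degree_eq_and_monic hlifts hqm
  have hint : IsIntegral Ok y := by
    refine ⟨q₀, hq₀m, ?_⟩
    rw [← Polynomial.aeval_def, ← Polynomial.aeval_map_algebraMap k, hq₀, hy]
  rw [minpoly.isIntegrallyClosed_eq_field_fractions' k hint, coeff_map]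
  exact ((minpoly Ok y).coeff i).2

end Denominators

/-! ### The primitive integral constant and the normal hull -/

section Primitive

variable {k Ω : Type u} [Field k] [Field Ω] [Algebra k Ω] [IsAlgClosed Ω]

/-- The normal hull in `Ω` of finitely many separable algebraic elements: the field generated
by all their `k`-conjugates is finite Galois over `k`, contains them, and contains every
`k`-conjugate of each of its elements. [folklore] -/
theorem exists_galois_hull (Y : Finset Ω) (hY : ∀ y ∈ Y, IsSeparable k y) :
    ∃ M₀ : IntermediateField k Ω, FiniteDimensional k M₀ ∧ IsGalois k M₀ ∧ (↑Y : Set Ω) ⊆ M₀ ∧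
      ∀ a ∈ M₀, ∀ β : Ω, aeval β (minpoly k a) = 0 → β ∈ M₀ := by
  classical
  have hYint : ∀ y ∈ Y, IsIntegral k y := fun y hy => (hY y hy).isIntegral
  set P : k[X] := ∏ y ∈ Y, minpoly k y with hP
  have hP0 : P ≠ 0 := Finset.prod_ne_zero_iff.mpr fun y hy => minpoly.ne_zero (hYint y hy)
  have hPsplit : (P.map (algebraMap k Ω)).Splits := IsAlgClosed.splits _
  set M₀ : IntermediateField k Ω := IntermediateField.adjoin k (P.rootSet Ω) with hM₀
  haveI : IsSplittingField k M₀ P := IntermediateField.adjoin_rootSet_isSplittingField hPsplit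
  haveI hnorm : Normal k M₀ := Normal.of_isSplittingField P
  -- the roots are separable over `k`
  have hroots : ∀ x ∈ P.rootSet Ω, IsIntegral k x ∧ IsSeparable k x := by
    intro x hx
    rw [hP, Polynomial.rootSet_prod _ _ (hP ▸ hP0), Set.mem_iUnion₂] at hx
    obtain ⟨y, hy, hxy⟩ := hx
    have hirr : Irreducible (minpoly k y) := minpoly.irreducible (hYint y hy)
    have hx0 := (Polynomial.mem_rootSet.mp hxy).2
    have hmin : minpoly k x = minpoly k y :=
      (minpoly.eq_of_irreducible_of_monic hirr hx0 (minpoly.monic (hYint y hy))).symm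
    have hxint : IsIntegral k x := by
      refine ⟨minpoly k y, minpoly.monic (hYint y hy), ?_⟩
      rwa [← Polynomial.aeval_def]
    refine ⟨hxint, ?_⟩
    change (minpoly k x).Separable
    rw [hmin]
    exact hY y hy
  haveI hfin : FiniteDimensional k M₀ := by
    haveI : Finite (P.rootSet Ω) := (Polynomial.rootSet_finite P Ω).to_subtype
    exact IntermediateField.finiteDimensional_adjoin fun x hx => (hroots x hx).1
  haveI hsep : Algebra.IsSeparable k M₀ :=
    (IntermediateField.isSeparable_adjoin_iff_isSeparable k Ω).mpr fun x hx => (hroots x hx).2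
  haveI : IsGalois k M₀ := IsGalois.mk
  refine ⟨M₀, hfin, inferInstance, fun y hy => ?_, fun a ha β hβ => ?_⟩
  · refine IntermediateField.subset_adjoin k _ (Polynomial.mem_rootSet.mpr ⟨hP0, ?_⟩)
    rw [hP, map_prod]
    exact Finset.prod_eq_zero hy (minpoly.aeval k y)
  · -- conjugates of elements of the normal `M₀` lie in `M₀`
    have ha' : IsIntegral k (⟨a, ha⟩ : M₀) := (hnorm.isIntegral _)
    have hsplits := hnorm.splits (⟨a, ha⟩ : M₀)
    have hmin : minpoly k (⟨a, ha⟩ : M₀) = minpoly k a := IntermediateField.minpoly_eq (⟨a, ha⟩ : M₀)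
    have haint : IsIntegral k a := ha'.map (IntermediateField.val M₀)
    have himg := hsplits.image_rootSet (IntermediateField.val M₀)
    have hβ' : β ∈ (minpoly k (⟨a, ha⟩ : M₀)).rootSet Ω := by
      rw [hmin]
      exact Polynomial.mem_rootSet.mpr ⟨minpoly.ne_zero haint, hβ⟩
    rw [← himg] at hβ'
    obtain ⟨z, -, rfl⟩ := hβ'
    exact z.2

variable (Ok : ValuationSubring k) (V : ValuationSubring Ω)

/-- **The primitive `k°`-integral constant.** Let `L ≤ Ω` be a subfield containing `k`, and
`Y ⊆ L` a finite set of elements separable over `k`. Then there are a finite Galois hull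
`M₀ ⊇ Y` of `k(Y)` in `Ω` (over `k`) and an element `y₀ ∈ L` with: `y₀ ∈ O_V` whenever
`k° ⊆ O_V`, `y₀` separable over `k` with minimal polynomial having coefficients in `k°`,
`Y ⊆ k(y₀) = M₀ ∩ L` (so `M₀ ∩ L ⊆ k(y₀)`), and every `k`-conjugate of an element of `M₀` in
`M₀`. [folklore] -/
theorem exists_primitive_integral_constant (hOkV : ∀ c ∈ Ok, algebraMap k Ω c ∈ V)
    (L : Subfield Ω) (hkL : ∀ c : k, algebraMap k Ω c ∈ L) (Y : Finset Ω) (hYL : (↑Y : Set Ω) ⊆ L)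
    (hY : ∀ y ∈ Y, IsSeparable k y) :
    ∃ (M₀ : IntermediateField k Ω) (y₀ : Ω), FiniteDimensional k M₀ ∧ IsGalois k M₀ ∧
      (∀ a ∈ M₀, ∀ β : Ω, aeval β (minpoly k a) = 0 → β ∈ M₀) ∧
      y₀ ∈ L ∧ y₀ ∈ V ∧ IsIntegral k y₀ ∧ IsSeparable k y₀ ∧
      (∀ i, (minpoly k y₀).coeff i ∈ Ok) ∧
      (↑Y : Set Ω) ⊆ IntermediateField.adjoin k ({y₀} : Set Ω) ∧
      (∀ z : Ω, z ∈ IntermediateField.adjoin k ({y₀} : Set Ω) ↔ z ∈ M₀ ∧ z ∈ L) := by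
  classical
  obtain ⟨M₀, hfin, hgal, hYM₀, hconj⟩ := exists_galois_hull Y hY
  haveI := hfin
  haveI := hgal
  -- `m' = M₀ ∩ L`
  let L' : IntermediateField k Ω := L.toIntermediateField hkL
  have hmemL' : ∀ z : Ω, z ∈ L' ↔ z ∈ L := fun _ => Iff.rfl
  let m' : IntermediateField k Ω := M₀ ⊓ L'
  have hm'M₀ : m' ≤ M₀ := inf_le_left
  haveI : FiniteDimensional k m' :=
    Module.Finite.of_injective (IntermediateField.inclusion hm'M₀).toLinearMap
      (IntermediateField.inclusion hm'M₀).injective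
  haveI : Algebra.IsSeparable k m' := Algebra.IsSeparable.of_algHom k M₀ (IntermediateField.inclusion hm'M₀)
  -- a primitive element `α` of `m'`
  obtain ⟨α, hα⟩ := Field.exists_primitive_element k m'
  have hαint : IsIntegral k (α : Ω) := (Algebra.IsIntegral.isIntegral (R := k) α).map (IntermediateField.val m')
  have hadjα : IntermediateField.adjoin k ({(α : Ω)} : Set Ω) = m' := by
    have h1 : (IntermediateField.adjoin k ({α} : Set m')).map (IntermediateField.val m') =
        IntermediateField.adjoin k ({(α : Ω)} : Set Ω) := by
      rw [IntermediateField.adjoin_map, Set.image_singleton]; rfl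
    rw [← h1, hα, ← AlgHom.fieldRange_eq_map, IntermediateField.fieldRange_val]
  have hmemm' : ∀ z : Ω, z ∈ m' ↔ z ∈ M₀ ∧ z ∈ L := fun z => IntermediateField.mem_inf
  -- scaling into `k°`-integrality
  obtain ⟨c, hc, hc0, q, hqm, hq, hqy⟩ := exists_smul_monic_coeff_mem Ok (α : Ω) hαint
  set y₀ : Ω := algebraMap k Ω c * α with hy₀def
  have hc0' : algebraMap k Ω c ≠ 0 := (_root_.map_ne_zero _).mpr hc0
  have hadj : IntermediateField.adjoin k ({y₀} : Set Ω) =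
      IntermediateField.adjoin k ({(α : Ω)} : Set Ω) := by
    apply le_antisymm
    · rw [IntermediateField.adjoin_simple_le_iff]
      exact mul_mem (IntermediateField.algebraMap_mem _ c)
        (IntermediateField.mem_adjoin_simple_self k (α : Ω))
    · rw [IntermediateField.adjoin_simple_le_iff]
      have : (α : Ω) = (algebraMap k Ω c)⁻¹ * y₀ := by
        rw [hy₀def, ← mul_assoc, inv_mul_cancel₀ hc0', one_mul]
      rw [this]
      exact mul_mem (inv_mem (IntermediateField.algebraMap_mem _ c))
        (IntermediateField.mem_adjoin_simple_self k y₀)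
  have hadjy₀ : IntermediateField.adjoin k ({y₀} : Set Ω) = m' := hadj.trans hadjα
  have hy₀m' : y₀ ∈ m' := hadjy₀ ▸ IntermediateField.mem_adjoin_simple_self k y₀
  have hy₀M₀ : y₀ ∈ M₀ := hm'M₀ hy₀m'
  have hy₀L : y₀ ∈ L := ((hmemm' y₀).mp hy₀m').2
  have hy₀int : IsIntegral k y₀ := ⟨q, hqm, by rwa [← aeval_def]⟩
  have hy₀sep : IsSeparable k y₀ := by
    have h := Algebra.IsSeparable.isSeparable k (⟨y₀, hy₀M₀⟩ : M₀)
    unfold IsSeparable at h ⊢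
    rwa [IntermediateField.minpoly_eq] at h
  have hy₀V : y₀ ∈ V :=
    mem_valuationSubring_of_isIntegral_map Ok V hOkV
      (isIntegral_map_valuationSubring_of_monic Ok hqm hq hqy)
  refine ⟨M₀, y₀, hfin, hgal, hconj, hy₀L, hy₀V, hy₀int, hy₀sep,
    fun i => coeff_minpoly_mem_of_monic Ok hqm hq hqy i, fun y hy => ?_, fun z => ?_⟩
  · rw [hadjy₀]
    exact (hmemm' y).mpr ⟨hYM₀ hy, hYL hy⟩
  · rw [hadjy₀]
    exact hmemm' z

omit [IsAlgClosed Ω] in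
/-- **The Galois hull over the constant field `m`, inside the algebraic closure of `m` in
`Ω`** (the shape of the fields `M, finM, galM, hML, hconjM` of the chart datum): a finite
Galois `M₀ ⊇ m ⊇ k` in `Ω` (over `k`), closed under `k`-conjugation, with `M₀ ∩ L ⊆ m`, becomes
an intermediate field `M` of `\overline{m}^{Ω}/m`, finite Galois over `m`, with `M ∩ L ⊆ m` and
containing every `k`-conjugate of every element of `m`. [folklore] -/
theorem exists_galois_over_constants (M₀ : IntermediateField k Ω) [FiniteDimensional k M₀]
    [IsGalois k M₀] (hconj : ∀ a ∈ M₀, ∀ β : Ω, aeval β (minpoly k a) = 0 → β ∈ M₀)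
    (m : Subfield Ω) (hkm : ∀ c : k, algebraMap k Ω c ∈ m) (hmM₀ : ∀ z ∈ m, z ∈ M₀)
    (L : Subfield Ω) (hML₀ : ∀ z ∈ M₀, z ∈ L → z ∈ m) :
    ∃ M : IntermediateField m (algebraicClosure m Ω), FiniteDimensional m M ∧ IsGalois m M ∧
      (∀ z : M, ((z : algebraicClosure m Ω) : Ω) ∈ L → ((z : algebraicClosure m Ω) : Ω) ∈ m) ∧
      (∀ a ∈ m, ∀ α : Ω, aeval α (minpoly k a) = 0 →
        ∃ z : M, ((z : algebraicClosure m Ω) : Ω) = α) := by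
  classical
  -- `k → m → Ω`
  letI ikm : Algebra k m := ((algebraMap k Ω).codRestrict m hkm).toAlgebra
  haveI : IsScalarTower k m Ω := IsScalarTower.of_algebraMap_eq fun _ => rfl
  -- elements of `M₀` are algebraic over `m`
  have halg : ∀ z ∈ M₀, IsAlgebraic m z := fun z hz =>
    IsAlgebraic.tower_top (K := k) m
      ((Algebra.IsIntegral.isIntegral (R := k) (⟨z, hz⟩ : M₀)).map
        (IntermediateField.val M₀)).isAlgebraic
  set AC : IntermediateField m Ω := algebraicClosure m Ω with hAC
  -- `M = M₀` seen inside `AC`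
  let MS : Subfield AC := M₀.toSubfield.comap (algebraMap AC Ω)
  have hMSmem : ∀ z : AC, z ∈ MS ↔ (z : Ω) ∈ M₀ := fun _ => Iff.rfl
  let M : IntermediateField m AC := MS.toIntermediateField fun c => by
    rw [hMSmem]; exact hmM₀ _ c.2
  have hMmem : ∀ z : AC, z ∈ M ↔ (z : Ω) ∈ M₀ := fun _ => Iff.rfl
  -- `k`-structure on `M` (through `m`) and the identification `M₀ ≃ₐ[k] M`
  haveI : IsScalarTower k m M := IsScalarTower.of_algebraMap_eq fun _ => rfl
  have hcoeM : ∀ c : k, (((algebraMap k M c : M) : AC) : Ω) = algebraMap k Ω c := fun _ => rfl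
  let f : M₀ → M := fun x =>
    ⟨⟨(x : Ω), mem_algebraicClosure_iff.mpr (halg x x.2)⟩, (hMmem _).mpr x.2⟩
  have hf : ∀ x : M₀, (((f x : M) : AC) : Ω) = x := fun _ => rfl
  let e₀ : M₀ ≃+* M :=
    { toFun := f
      invFun := fun z => ⟨((z : AC) : Ω), (hMmem _).mp z.2⟩
      left_inv := fun _ => rfl
      right_inv := fun _ => rfl
      map_mul' := fun _ _ => rfl
      map_add' := fun _ _ => rfl }
  let e : M₀ ≃ₐ[k] M := AlgEquiv.ofRingEquiv (f := e₀) fun c => by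
    apply Subtype.ext; apply Subtype.ext
    show ((algebraMap k M₀ c : M₀) : Ω) = (((algebraMap k M c : M) : AC) : Ω)
    rw [hcoeM]; rfl
  haveI : FiniteDimensional k M := LinearEquiv.finiteDimensional e.toLinearEquiv
  haveI : Normal k M := Normal.of_algEquiv e
  haveI : Algebra.IsSeparable k M := Algebra.IsSeparable.of_algHom k M₀ e.symm.toAlgHom
  haveI : FiniteDimensional m M := Module.Finite.of_restrictScalars_finite k m M
  haveI : Algebra.IsSeparable m M := Algebra.isSeparable_tower_top_of_isSeparable k m M
  haveI : Normal m M := Normal.tower_top_of_normal k m M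
  haveI : IsGalois m M := IsGalois.mk
  refine ⟨M, inferInstance, inferInstance, fun z hzL => hML₀ _ ((hMmem _).mp z.2) hzL,
    fun a ha α hα => ?_⟩
  have hαM₀ : α ∈ M₀ := hconj a (hmM₀ a ha) α hα
  exact ⟨f ⟨α, hαM₀⟩, rfl⟩

end Primitive

end Literature.AlgebraicGeometry.Resolution

end
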